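import Literature.Computability.AlgebraicComplexity.FormSingularLocusPrime
import Literature.Algebra.Polynomial.JacobianCriterion
import Literature.RingTheory.KrullDimension.TangentDimension
import Mathlib.Algebra.DualNumber
import HarnessLib

/-!
# The singular forms of degree `D` form a hypersurface (the discriminant locus, IIa): a sub-family
# with `N − 1` algebraically independent coefficient functions

Topic `Literature/Computability/AlgebraicComplexity` (cell `val-lit`, row BI2017-A, programme
"`BI2017_prop_2_10` without Popov", brick (3): existence of the discriminant). Continuation of
`FormSingularLocusPrime.lean` (the ideal `I_S = ker (Φ ↦ Φ(singFamilyCoeff))` of polynomial functions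
on `Sym^D ℂ^{n+2}` vanishing on all singular forms is a non-zero prime). This file supplies the
dimension LOWER bound behind `height I_S ≤ 1` (file `FormSingularLocusHeight.lean`): the sub-family
`F(x₀, x₁ + b₁x₀, …, x_{n+1} + b_{n+1}x₀)`, `F = singBaseForm c` singular at `e₀`
(`FormDiscriminant.uForm`, universal version `uFormUniv` over `ℂ[c, b]`, `N − 1` parameters
`UVars n D`), is a specialisation of the singular family (`ker_singFamily_le_ker_uFamily`) and has
`N − 1` ALGEBRAICALLY INDEPENDENT coefficient functions (`algebraicIndependent_uJacFamily`) — by the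
tree's JACOBIAN CRITERION (`Literature.Algebra.Polynomial.JacobianCriterion`, Humphreys § 3.10) at
the point `(b = 0, F₀ = x₀^{D-2} Σ_j x_j²)`, where the Jacobian is block triangular with diagonal
blocks `1` and `2·1`; the derivative in `b_k` is read off with dual numbers
(`KrullDimension.snd_aeval_dualNumberPoint`) from the first-order expansion
`(1 + ε E_{ij}) · F = F + ε x_i ∂_j F` (`linSubst_one_add_smul_single`, Springer 4.1.2).
Honest framing: classical algebraic geometry; nothing here bears on `VP ≠ VNP`.

## References

* I. M. Gelfand, M. M. Kapranov, A. V. Zelevinsky, *Discriminants, Resultants, and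
  Multidimensional Determinants* (1994), Ch. 1 §1. [GelfandKapranovZelevinsky1994]
* D. Mumford, J. Fogarty, F. Kirwan, *Geometric Invariant Theory*, 3rd ed., Ch. 4 §2, Prop. 4.2.
  [MumfordFogartyKirwan1994]
* J. E. Humphreys, *Reflection Groups and Coxeter Groups*, § 3.10 (Jacobian criterion). [Humphreys1990]
* T. A. Springer, *Linear Algebraic Groups*, 4.1.2 (dual numbers). [SpringerLAG1998]
-/

noncomputable section

open MvPolynomial Matrix

namespace Literature.Computability.AlgebraicComplexity

open Literature.AlgebraicGeometry.Motives.SmoothHypersurface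
open Literature.Algebra.Polynomial.JacobianCriterion

namespace FormDiscriminant

variable {n D : ℕ}

/-! ### The one-parameter unipotent substitutions `x_j ↦ x_j + ε x_i`: first-order expansion -/

section FirstOrder

variable {R : Type*} [CommRing R]

/-- The column of `1 + ε E_{ij}` acting on `x_l`: `x_l ↦ x_l + [l = j] ε x_i`. [folklore] -/
private theorem sum_one_add_smul_single_smul_X {m : ℕ} (ε : R) (i j l : Fin m) :
    (∑ j', (1 + ε • Matrix.single i j (1 : R)) j' l • X j' : MvPolynomial (Fin m) R) =
      X l + (if l = j then ε • X i else 0) := by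
  classical
  have hentry : ∀ j', (1 + ε • Matrix.single i j (1 : R)) j' l =
      (if j' = l then 1 else 0) + (if i = j' ∧ j = l then ε else 0) := by
    intro j'
    simp only [Matrix.add_apply, Matrix.one_apply, Matrix.smul_apply, Matrix.single,
      Matrix.of_apply, smul_eq_mul, mul_ite, mul_one, mul_zero]
  simp_rw [hentry, add_smul, Finset.sum_add_distrib, ite_smul, one_smul, zero_smul,
    Finset.sum_ite_eq', Finset.mem_univ, if_true]
  congr 1
  by_cases hl : l = j
  · subst hl
    simp only [and_true, if_true]
    rw [Finset.sum_ite_eq, if_pos (Finset.mem_univ _)]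
  · rw [if_neg hl]
    refine Finset.sum_eq_zero fun j' _ => ?_
    rw [if_neg (fun h => hl h.2.symm)]

/-- **First-order expansion of a unipotent substitution**: for `ε² = 0`,
`(1 + ε E_{ij}) · F = F + ε · x_i ∂_j F` (the substitution `x_j ↦ x_j + ε x_i`; Taylor to first
order — Springer 4.1.2 "`p(x + tv) ≡ p(x) + t Σ vᵢ ∂p/∂Tᵢ (x) mod t²`").
[cite: SpringerLAG1998, 4.1.2] -/
theorem linSubst_one_add_smul_single {m : ℕ} {ε : R} (hε : ε * ε = 0) (i j : Fin m)
    (F : MvPolynomial (Fin m) R) :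
    linSubst (Fin m) R (1 + ε • Matrix.single i j (1 : R)) F = F + ε • (X i * pderiv j F) := by
  classical
  induction F using MvPolynomial.induction_on with
  | C a => rw [linSubst_C, pderiv_C, mul_zero, smul_zero, add_zero]
  | add p q hp hq => rw [map_add, hp, hq, map_add, mul_add, smul_add]; abel
  | mul_X p l hp =>
    rw [map_mul, hp, linSubst_X, sum_one_add_smul_single_smul_X, Derivation.leibniz, pderiv_X,
      smul_eq_mul, smul_eq_mul]
    have hε' : (C ε : MvPolynomial (Fin m) R) * C ε = 0 := by rw [← C_mul, hε, C_0]
    by_cases hl : l = j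
    · subst hl
      simp only [if_true, Pi.single_eq_same, mul_one, smul_eq_C_mul]
      linear_combination (X i * pderiv l p * X i) * hε'
    · simp only [if_neg hl, Pi.single_eq_of_ne hl, mul_zero, zero_add, add_zero, smul_eq_C_mul]
      ring

end FirstOrder

/-! ### The sub-family `F(x₀, x_j + b_j x₀)` of forms singular at `e₀` -/

section UFamily

/-- The free coefficient indices: degree-`D` exponents `e` with `e₀ + 2 ≤ D`.
[cite: MumfordFogartyKirwan1994, Ch. 4 §2, Prop. 4.2 (proof: singular point at (1,0,…,0))] -/
abbrev FreeIdx (n D : ℕ) : Type := {e : DegIdx (Fin (n + 2)) D // e.1 0 + 2 ≤ D}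

/-- The parameters of the sub-family: free coefficients `c_e` and slopes `b_k` (`k + 1` = the moved
variable). [cite: GelfandKapranovZelevinsky1994, Ch. 1 §1 (the discriminant hypersurface)] -/
abbrev UVars (n D : ℕ) : Type := FreeIdx n D ⊕ Fin (n + 1)

variable (R : Type*) [CommRing R]

/-- The unipotent matrix `1 + Σ_k b_k E_{0,k+1}` (substitution `x_{k+1} ↦ x_{k+1} + b_k x₀`).
[cite: GelfandKapranovZelevinsky1994, Ch. 1 §1 (the discriminant hypersurface)] -/
def uMatrix (b : Fin (n + 1) → R) : Matrix (Fin (n + 2)) (Fin (n + 2)) R :=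
  1 + ∑ k, b k • Matrix.single 0 k.succ (1 : R)

/-- Extension of free coefficients by zero to all degree-`D` exponents.
[cite: MumfordFogartyKirwan1994, Ch. 4 §2, Prop. 4.2 (proof: singular point at (1,0,…,0))] -/
def uCoeffVec (c : FreeIdx n D → R) : DegIdx (Fin (n + 2)) D → R :=
  fun e => if h : e.1 0 + 2 ≤ D then c ⟨e, h⟩ else 0

/-- The sub-family `(1 + Σ b_k E_{0,k+1}) · singBaseForm c`.
[cite: GelfandKapranovZelevinsky1994, Ch. 1 §1 (the discriminant hypersurface)] -/
def uForm (b : Fin (n + 1) → R) (c : FreeIdx n D → R) : MvPolynomial (Fin (n + 2)) R :=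
  linSubst (Fin (n + 2)) R (uMatrix R b) (singBaseForm R (uCoeffVec R c))

variable {R}

/-- Base change for `uMatrix`. [folklore] -/
private theorem map_uMatrix {S : Type*} [CommRing S] (φ : R →+* S) (b : Fin (n + 1) → R) :
    (uMatrix R b).map φ = uMatrix S (φ ∘ b) := by
  ext i j
  simp only [uMatrix, Matrix.map_apply, Matrix.add_apply, Matrix.one_apply, map_add,
    Matrix.sum_apply, Matrix.smul_apply, smul_eq_mul, map_sum, map_mul, Function.comp_apply,
    Matrix.single, Matrix.of_apply, apply_ite φ, map_one, map_zero]

/-- Base change for `uCoeffVec`. [folklore] -/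
private theorem comp_uCoeffVec {S : Type*} [CommRing S] (φ : R →+* S) (c : FreeIdx n D → R) :
    φ ∘ uCoeffVec R c = uCoeffVec S (φ ∘ c) := by
  funext e
  simp only [Function.comp_apply, uCoeffVec]
  split_ifs
  · rfl
  · exact map_zero φ

/-- Base change for `linSubst` (private copy of the tree lemma of `BLMW11HilbertKraftReduction`).
[folklore] -/
private theorem map_linSubst'' {σ S : Type*} [Fintype σ] [CommRing S] (θ : R →+* S)
    (A : Matrix σ σ R) (p : MvPolynomial σ R) :
    MvPolynomial.map θ (linSubst σ R A p) = linSubst σ S (A.map θ) (MvPolynomial.map θ p) := by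
  change MvPolynomial.map θ (aeval _ p) = aeval _ (MvPolynomial.map θ p)
  rw [aeval_eq_bind₁, aeval_eq_bind₁, map_bind₁]
  congr 2
  funext i
  simp only [map_sum, smul_eq_C_mul, map_mul, map_C, map_X, Matrix.map_apply]

/-- **Base change**: ring maps act on the sub-family through the parameters. [folklore] -/
private theorem map_uForm {S : Type*} [CommRing S] (φ : R →+* S) (b : Fin (n + 1) → R)
    (c : FreeIdx n D → R) :
    MvPolynomial.map φ (uForm R b c) = uForm S (φ ∘ b) (φ ∘ c) := by
  unfold uForm
  rw [map_linSubst'', map_uMatrix, map_singBaseForm, comp_uCoeffVec]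

/-- At `b = 0` the matrix is the identity. [folklore] -/
private theorem uMatrix_zero : uMatrix R (0 : Fin (n + 1) → R) = 1 := by
  simp [uMatrix]

/-! ### The universal sub-family and its comorphism -/

/-- The exponent read by the coordinate function attached to a parameter: `e` for `c_e`,
`(D-1)e₀ + e_{k+1}` for `b_k`. [cite: GelfandKapranovZelevinsky1994, Ch. 1 §1 (the discriminant hypersurface)] -/
def uExp : UVars n D → (Fin (n + 2) →₀ ℕ) :=
  Sum.elim (fun e => e.1.1) (fun k => Finsupp.single 0 (D - 1) + Finsupp.single k.succ 1)

/-- The universal sub-family over its own parameter ring `ℂ[c, b]`.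
[cite: GelfandKapranovZelevinsky1994, Ch. 1 §1 (the discriminant hypersurface)] -/
def uFormUniv (n D : ℕ) : MvPolynomial (Fin (n + 2)) (MvPolynomial (UVars n D) ℂ) :=
  uForm (MvPolynomial (UVars n D) ℂ) (fun k => X (Sum.inr k)) (fun e => X (Sum.inl e))

/-- The `N − 1` coordinate functions of the sub-family: `f_v = coeff_{uExp v} (uFormUniv)`, a square
system `UVars → ℂ[UVars]`. [cite: GelfandKapranovZelevinsky1994, Ch. 1 §1 (the discriminant hypersurface)] -/
def uJacFamily (v : UVars n D) : MvPolynomial (UVars n D) ℂ :=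
  coeff (uExp v) (uFormUniv n D)

/-- All `N` coefficient functions of the sub-family (its comorphism `ℂ[Sym^D] → ℂ[c, b]`).
[cite: GelfandKapranovZelevinsky1994, Ch. 1 §1 (the discriminant hypersurface)] -/
def uFamilyCoeff (d : DegIdx (Fin (n + 2)) D) : MvPolynomial (UVars n D) ℂ :=
  coeff d.1 (uFormUniv n D)

/-- Evaluating the universal sub-family at an `S`-valued point `q` of parameter space gives the
sub-family with parameters `q`. [folklore] -/
private theorem map_aeval_uFormUniv {S : Type*} [CommRing S] [Algebra ℂ S] (q : UVars n D → S) :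
    MvPolynomial.map (aeval (R := ℂ) q : MvPolynomial (UVars n D) ℂ →+* S) (uFormUniv n D) =
      uForm S (fun k => q (Sum.inr k)) (fun e => q (Sum.inl e)) := by
  have h1 : ((aeval (R := ℂ) q : MvPolynomial (UVars n D) ℂ →+* S) : MvPolynomial (UVars n D) ℂ → S)
      ∘ (fun k : Fin (n + 1) => (X (Sum.inr k) : MvPolynomial (UVars n D) ℂ)) =
      fun k => q (Sum.inr k) := by
    funext k
    simp
  have h2 : ((aeval (R := ℂ) q : MvPolynomial (UVars n D) ℂ →+* S) : MvPolynomial (UVars n D) ℂ → S)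
      ∘ (fun e : FreeIdx n D => (X (Sum.inl e) : MvPolynomial (UVars n D) ℂ)) =
      fun e => q (Sum.inl e) := by
    funext e
    simp
  unfold uFormUniv
  rw [map_uForm, h1, h2]

/-- The sub-family is a specialisation of the full singular family of part I: `Y ↦ uMatrix b`,
`c ↦ uCoeffVec c`. [folklore] -/
private theorem aeval_singFamilyCoeff_eq_uFamilyCoeff (d : DegIdx (Fin (n + 2)) D) :
    aeval (R := ℂ) (Sum.elim (fun ij : Fin (n + 2) × Fin (n + 2) =>
        uMatrix (MvPolynomial (UVars n D) ℂ) (fun k => X (Sum.inr k)) ij.1 ij.2)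
      (uCoeffVec (MvPolynomial (UVars n D) ℂ) fun e => X (Sum.inl e))) (singFamilyCoeff d) =
      uFamilyCoeff (n := n) (D := D) d := by
  set q : SingVars n D → MvPolynomial (UVars n D) ℂ := Sum.elim
    (fun ij : Fin (n + 2) × Fin (n + 2) =>
      uMatrix (MvPolynomial (UVars n D) ℂ) (fun k => X (Sum.inr k)) ij.1 ij.2)
    (uCoeffVec (MvPolynomial (UVars n D) ℂ) fun e => X (Sum.inl e)) with hq
  have hY : (Matrix.of fun i j => (X (Sum.inl (i, j)) : MvPolynomial (SingVars n D) ℂ)).map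
      (aeval (R := ℂ) q : MvPolynomial (SingVars n D) ℂ →+* MvPolynomial (UVars n D) ℂ) =
      uMatrix (MvPolynomial (UVars n D) ℂ) (fun k => X (Sum.inr k)) := by
    ext i j
    rw [Matrix.map_apply, Matrix.of_apply, RingHom.coe_coe, aeval_X, hq, Sum.elim_inl]
  have hc : ((aeval (R := ℂ) q : MvPolynomial (SingVars n D) ℂ →+* MvPolynomial (UVars n D) ℂ) :
      MvPolynomial (SingVars n D) ℂ → MvPolynomial (UVars n D) ℂ) ∘
      (fun e : DegIdx (Fin (n + 2)) D => (X (Sum.inr e) : MvPolynomial (SingVars n D) ℂ)) =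
      uCoeffVec (MvPolynomial (UVars n D) ℂ) fun e => X (Sum.inl e) := by
    funext e
    show aeval q (X (Sum.inr e)) = _
    rw [aeval_X, hq, Sum.elim_inr]
  unfold singFamilyCoeff uFamilyCoeff uFormUniv uForm
  rw [← RingHom.coe_coe, ← coeff_map, map_linSubst'', hY, map_singBaseForm, hc]

/-- **The ideal of the singular locus is contained in the kernel of the sub-family's comorphism**
(the sub-family consists of singular forms). [cite: GelfandKapranovZelevinsky1994, Ch. 1 §1 (the discriminant hypersurface)] -/
theorem ker_singFamily_le_ker_uFamily :
    RingHom.ker (aeval (R := ℂ) (singFamilyCoeff (n := n) (D := D))).toRingHom ≤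
      RingHom.ker (aeval (R := ℂ) (uFamilyCoeff (n := n) (D := D))).toRingHom := by
  intro Φ hΦ
  rw [RingHom.mem_ker] at hΦ ⊢
  simp only [AlgHom.toRingHom_eq_coe, RingHom.coe_coe] at hΦ ⊢
  have h : (aeval (R := ℂ) (uFamilyCoeff (n := n) (D := D))) =
      (aeval (R := ℂ) (Sum.elim (fun ij : Fin (n + 2) × Fin (n + 2) =>
        uMatrix (MvPolynomial (UVars n D) ℂ) (fun k => X (Sum.inr k)) ij.1 ij.2)
        (uCoeffVec (MvPolynomial (UVars n D) ℂ) fun e => X (Sum.inl e)))).comp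
      (aeval (R := ℂ) (singFamilyCoeff (n := n) (D := D))) := by
    rw [comp_aeval]
    congr 1
    funext d
    exact (aeval_singFamilyCoeff_eq_uFamilyCoeff d).symm
  rw [h, AlgHom.comp_apply, hΦ, map_zero]

/-! ### The Jacobian at the point `(c₀, 0)`, `F₀ = x₀^{D-2} Σ_j x_j²` -/

/-- The base point form `F₀ = Σ_k x₀^{D-2} x_{k+1}²`. [folklore] -/
private def baseForm (n D : ℕ) : MvPolynomial (Fin (n + 2)) ℂ :=
  ∑ k : Fin (n + 1), monomial (Finsupp.single 0 (D - 2) + Finsupp.single k.succ 2) 1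

/-- The free coefficients of `F₀`. [folklore] -/
private def baseCoeff (n D : ℕ) : FreeIdx n D → ℂ := fun e => coeff e.1.1 (baseForm n D)

/-- The base point of parameter space: `c = baseCoeff`, `b = 0`. [folklore] -/
private def basePt (n D : ℕ) : UVars n D → ℂ := Sum.elim (baseCoeff n D) 0

/-- `F₀` has only free monomials (`D ≥ 2`): `singBaseForm (uCoeffVec baseCoeff) = F₀`. [folklore] -/
private theorem singBaseForm_baseCoeff (hD : 2 ≤ D) :
    singBaseForm ℂ (uCoeffVec ℂ (baseCoeff n D)) = baseForm n D := by
  classical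
  apply MvPolynomial.ext
  intro d
  rw [coeff_singBaseForm]
  by_cases hd : d.degree = D
  · rw [dif_pos hd]
    split_ifs with hfree
    · rw [uCoeffVec, dif_pos hfree]
      rfl
    · -- `d` is not free: its coefficient in `F₀` vanishes
      unfold baseForm
      rw [coeff_sum]
      refine (Finset.sum_eq_zero fun k _ => ?_).symm
      rw [coeff_monomial, if_neg]
      intro h
      apply hfree
      rw [← h, Finsupp.add_apply, Finsupp.single_eq_same,
        Finsupp.single_eq_of_ne (Fin.succ_ne_zero k).symm]
      omega
  · rw [dif_neg hd]
    unfold baseForm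
    rw [coeff_sum]
    refine (Finset.sum_eq_zero fun k _ => ?_).symm
    rw [coeff_monomial, if_neg]
    intro h
    apply hd
    rw [← h, map_add, Finsupp.degree_single, Finsupp.degree_single]
    omega

/-- The derivative data: `x₀ ∂_{k+1} F₀ = 2 x₀^{D-1} x_{k+1}`. [folklore] -/
private theorem X_mul_pderiv_baseForm (hD : 2 ≤ D) (k : Fin (n + 1)) :
    (X 0 * pderiv k.succ (baseForm n D) : MvPolynomial (Fin (n + 2)) ℂ) =
      monomial (Finsupp.single 0 (D - 1) + Finsupp.single k.succ 1) 2 := by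
  classical
  unfold baseForm
  rw [map_sum, Finset.mul_sum, Finset.sum_eq_single k]
  · rw [pderiv_monomial, Finsupp.add_apply, Finsupp.single_eq_of_ne (Fin.succ_ne_zero k),
      Finsupp.single_eq_same, zero_add, X, monomial_mul, one_mul]
    have hexp : (Finsupp.single 0 1 : Fin (n + 2) →₀ ℕ) +
        (Finsupp.single 0 (D - 2) + Finsupp.single k.succ 2 - Finsupp.single k.succ 1) =
        Finsupp.single 0 (D - 1) + Finsupp.single k.succ 1 := by
      have h2 : (Finsupp.single k.succ 2 : Fin (n + 2) →₀ ℕ) =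
          Finsupp.single k.succ 1 + Finsupp.single k.succ 1 := by
        rw [← Finsupp.single_add]
      rw [h2, ← add_assoc, add_tsub_cancel_right, ← add_assoc, ← Finsupp.single_add]
      congr 2
      omega
    rw [hexp]
    norm_num
  · intro k' _ hk'
    rw [pderiv_monomial, Finsupp.add_apply, Finsupp.single_eq_of_ne (Fin.succ_ne_zero k),
      Finsupp.single_eq_of_ne (fun h => hk' (Fin.succ_injective _ h).symm), zero_add]
    simp
  · intro h; exact absurd (Finset.mem_univ k) h

open TrivSqZeroExt DualNumber Literature.RingTheory.KrullDimension in
/-- **The Jacobian at the base point via dual numbers**: the `(r, v)` entry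
`(∂ f_r / ∂ v)(c₀, 0)` equals the `ε`-part of `coeff_{uExp r}` of the sub-family over `ℂ[ε]` at the
point `(c₀, 0) + ε δ_v`. [cite: SpringerLAG1998, 4.1.2 and 4.1.9 (3)] -/
private theorem eval_basePt_pderiv_uJacFamily (r v : UVars n D) :
    eval (basePt n D) (pderiv v (uJacFamily r)) =
      snd (coeff (uExp r) (uForm ℂ[ε]
        (fun k => dualNumberPoint (basePt n D) (Pi.single v 1) (Sum.inr k))
        (fun e => dualNumberPoint (basePt n D) (Pi.single v 1) (Sum.inl e)))) := by
  classical
  have h := snd_aeval_dualNumberPoint (basePt n D) (Pi.single v (1 : ℂ)) (uJacFamily r)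
  rw [linearFormOfVector_apply, Finset.sum_eq_single v (fun i _ hi => by
      rw [Pi.single_eq_of_ne hi, mul_zero]) (fun h => absurd (Finset.mem_univ v) h),
    Pi.single_eq_same, mul_one] at h
  rw [← h]
  unfold uJacFamily
  rw [← RingHom.coe_coe, ← coeff_map, map_aeval_uFormUniv]

open TrivSqZeroExt DualNumber Literature.RingTheory.KrullDimension in
/-- The Jacobian column of a free coefficient `c_{e'}` at the base point: `δ_{uExp r, e'}`.
[cite: SpringerLAG1998, 4.1.2 and 4.1.9 (3)] -/
private theorem eval_basePt_pderiv_uJacFamily_inl (r : UVars n D) (e' : FreeIdx n D) :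
    eval (basePt n D) (pderiv (Sum.inl e') (uJacFamily r)) =
      if uExp r = e'.1.1 then 1 else 0 := by
  classical
  rw [eval_basePt_pderiv_uJacFamily]
  -- the slopes vanish: the matrix is `1`
  have hb : (fun k => dualNumberPoint (basePt n D) (Pi.single (Sum.inl e') (1 : ℂ)) (Sum.inr k)) =
      (0 : Fin (n + 1) → ℂ[ε]) := by
    funext k
    simp [dualNumberPoint, basePt]
  rw [hb, uForm, uMatrix_zero, linSubst_one, AlgHom.id_apply, coeff_singBaseForm]
  by_cases hd : (uExp r).degree = D
  · rw [dif_pos hd]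
    by_cases hfree : uExp r 0 + 2 ≤ D
    · rw [if_pos hfree, uCoeffVec, dif_pos hfree]
      simp only [dualNumberPoint, basePt, Sum.elim_inl, snd_add, snd_inl, snd_inr, zero_add,
        Pi.single_apply, Sum.inl.injEq]
      by_cases h : uExp r = e'.1.1
      · rw [if_pos h, if_pos]
        exact Subtype.ext (Subtype.ext h)
      · rw [if_neg h, if_neg]
        intro h'
        exact h (congrArg (fun x : FreeIdx n D => x.1.1) h')
    · rw [if_neg hfree, snd_zero, if_neg]
      intro h
      exact hfree (h ▸ e'.2)
  · rw [dif_neg hd, snd_zero, if_neg]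
    intro h
    exact hd (h ▸ mem_degMonomials_iff.1 e'.1.2)

open TrivSqZeroExt DualNumber Literature.RingTheory.KrullDimension in
/-- The Jacobian column of a slope `b_k` at the base point: `coeff_{uExp r} (x₀ ∂_{k+1} F₀)` — the
first-order expansion of the unipotent substitution. [cite: SpringerLAG1998, 4.1.2 and 4.1.9 (3)] -/
private theorem eval_basePt_pderiv_uJacFamily_inr (hD : 2 ≤ D) (r : UVars n D) (k : Fin (n + 1)) :
    eval (basePt n D) (pderiv (Sum.inr k) (uJacFamily r)) =
      coeff (uExp r) (X 0 * pderiv k.succ (baseForm n D) : MvPolynomial (Fin (n + 2)) ℂ) := by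
  classical
  rw [eval_basePt_pderiv_uJacFamily]
  -- the coefficients have no `ε`-part: the base form is `F₀` extended to `ℂ[ε]`
  have hc : (fun e => dualNumberPoint (basePt n D) (Pi.single (Sum.inr k) (1 : ℂ)) (Sum.inl e)) =
      (TrivSqZeroExt.inlHom ℂ ℂ : ℂ →+* ℂ[ε]) ∘ baseCoeff n D := by
    funext e
    simp [dualNumberPoint, basePt]
  -- the matrix is `1 + ε E_{0,k+1}`
  have hb : uMatrix ℂ[ε]
      (fun k' => dualNumberPoint (basePt n D) (Pi.single (Sum.inr k) (1 : ℂ)) (Sum.inr k')) =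
      1 + (ε : ℂ[ε]) • Matrix.single 0 k.succ (1 : ℂ[ε]) := by
    unfold uMatrix
    congr 1
    rw [Finset.sum_eq_single k]
    · congr 1
      simp [dualNumberPoint, basePt, DualNumber.eps, TrivSqZeroExt.inr]
    · intro k' _ hk'
      have : dualNumberPoint (basePt n D) (Pi.single (Sum.inr k) (1 : ℂ)) (Sum.inr k') = 0 := by
        simp [dualNumberPoint, basePt, hk']
      simp only [this, zero_smul]
    · intro h; exact absurd (Finset.mem_univ k) h
  have hF : singBaseForm ℂ[ε] (uCoeffVec ℂ[ε]
      ((TrivSqZeroExt.inlHom ℂ ℂ : ℂ →+* ℂ[ε]) ∘ baseCoeff n D)) =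
      MvPolynomial.map (TrivSqZeroExt.inlHom ℂ ℂ : ℂ →+* ℂ[ε]) (baseForm n D) := by
    rw [← comp_uCoeffVec, ← map_singBaseForm, singBaseForm_baseCoeff hD]
  rw [uForm, hb, hc, hF, linSubst_one_add_smul_single DualNumber.eps_mul_eps, coeff_add,
    coeff_smul, coeff_map, smul_eq_mul, snd_add]
  have hq : (X 0 * pderiv k.succ (MvPolynomial.map (TrivSqZeroExt.inlHom ℂ ℂ : ℂ →+* ℂ[ε])
      (baseForm n D)) : MvPolynomial (Fin (n + 2)) ℂ[ε]) =
      MvPolynomial.map (TrivSqZeroExt.inlHom ℂ ℂ : ℂ →+* ℂ[ε]) (X 0 * pderiv k.succ (baseForm n D)) := by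
    rw [map_mul, map_X, pderiv_map]
  rw [hq, coeff_map, DualNumber.snd_mul, fst_eps, snd_eps, zero_mul, zero_add, one_mul]
  simp

/-- **The Jacobian of the sub-family at the base point is invertible**: it is block triangular
with diagonal blocks `1` (free coefficients) and `2·1` (slopes). [cite: Humphreys1990, § 3.10 (Proposition)] -/
private theorem det_jacobianMatrix_uJacFamily_ne_zero (hD : 2 ≤ D) :
    (jacobianMatrix (uJacFamily (n := n) (D := D))).det ≠ 0 := by
  classical
  intro hdet
  have h := congrArg (eval (basePt n D)) hdet
  rw [map_zero, RingHom.map_det] at h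
  -- identify the evaluated Jacobian with a block-triangular matrix
  set B : Matrix (FreeIdx n D) (Fin (n + 1)) ℂ := Matrix.of fun e k =>
    coeff e.1.1 (X 0 * pderiv k.succ (baseForm n D) : MvPolynomial (Fin (n + 2)) ℂ) with hB
  have hJ : (RingHom.mapMatrix (eval (basePt n D)))
      (jacobianMatrix (uJacFamily (n := n) (D := D))) =
      Matrix.fromBlocks 1 B 0 ((2 : ℂ) • 1) := by
    ext r v
    rw [RingHom.mapMatrix_apply, Matrix.map_apply, jacobianMatrix_apply]
    rcases r with e | k' <;> rcases v with e' | k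
    · rw [eval_basePt_pderiv_uJacFamily_inl, Matrix.fromBlocks_apply₁₁, Matrix.one_apply]
      simp only [uExp, Sum.elim_inl]
      by_cases h : e = e'
      · subst h; simp
      · rw [if_neg, if_neg h]
        intro h'
        exact h (Subtype.ext (Subtype.ext h'))
    · rw [eval_basePt_pderiv_uJacFamily_inr hD, Matrix.fromBlocks_apply₁₂, hB, Matrix.of_apply]
      rfl
    · rw [eval_basePt_pderiv_uJacFamily_inl, Matrix.fromBlocks_apply₂₁, Matrix.zero_apply, if_neg]
      simp only [uExp, Sum.elim_inr]
      intro h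
      have := e'.2
      rw [← h, Finsupp.add_apply, Finsupp.single_eq_same,
        Finsupp.single_eq_of_ne (Fin.succ_ne_zero k').symm] at this
      omega
    · rw [eval_basePt_pderiv_uJacFamily_inr hD, Matrix.fromBlocks_apply₂₂, X_mul_pderiv_baseForm hD,
        coeff_monomial, Matrix.smul_apply, Matrix.one_apply, smul_eq_mul]
      simp only [uExp, Sum.elim_inr]
      by_cases h : k' = k
      · subst h; simp
      · rw [if_neg, if_neg h, mul_zero]
        intro h'
        apply h
        have h2 := congrArg (fun f : Fin (n + 2) →₀ ℕ => f k'.succ) h'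
        simp only [Finsupp.add_apply, Finsupp.single_eq_same,
          Finsupp.single_eq_of_ne (Fin.succ_ne_zero k'), zero_add] at h2
        by_contra hne
        rw [Finsupp.single_eq_of_ne (fun h'' => hne (Fin.succ_injective _ h''))] at h2
        exact one_ne_zero h2.symm
  rw [hJ, Matrix.det_fromBlocks_zero₂₁, Matrix.det_one, one_mul, Matrix.det_smul, Matrix.det_one,
    mul_one] at h
  exact pow_ne_zero _ two_ne_zero h

/-- **The `N − 1` coordinate functions of the sub-family are algebraically independent over `ℂ`**
(Jacobian criterion). [cite: Humphreys1990, § 3.10 (Proposition)] -/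
theorem algebraicIndependent_uJacFamily (hD : 2 ≤ D) :
    AlgebraicIndependent ℂ (uJacFamily (n := n) (D := D)) :=
  (algebraicIndependent_iff_det_jacobianMatrix_ne_zero _).2
    (det_jacobianMatrix_uJacFamily_ne_zero hD)

end UFamily

end FormDiscriminant

end Literature.Computability.AlgebraicComplexity

end
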